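import Summits.ResolutionOfSingularities.ResolutionOfSingularities.Theorems.WeightedInvariantLocalWeightedDropNCTameBinomialRungClosed

/-!
# W4.3 `LocalWeightedDrop` — TOT rung R7, corollaries: TAME SUSPENSION TOWERS are finitely winnable in every dimension, FACT-FREE

[OURS · L1 W4.3 · chain w43, engine crux `LocalWeightedDrop` stmt-ResolutionOfSingularities-8899, line `nc-game-transport`; corollary layer of TOT rung
R7 (`…NCTameBinomialEndGame` p526360 / `…NCTameBinomialRung` p527379 / `…NCTameBinomialRungClosed` p528281; design res-L1-w43-strat-1, hands res-D-pv-006 /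
res-D-pv-036); this file res-D-pv-036.  Bookkeeping on the programme's own NC count game; NOT a statement of the manuscript under review
([claim: Hironaka2017, status: under-review]); nothing here is attributed to its author; closes no stub by name (`--supports stmt-ResolutionOfSingularities-8899`).]

THE STEP.  `exists_winsIn_tameSuspension_step`: over EVERY field, if a non-zero germ `h ∈ k⟦x_0, …, x_m⟧` is won by the mover of the NC count game within
finitely many rounds and `(d : k) ≠ 0`, then so is its TAME SUSPENSION `x_{m+1} ^ d + h` in `m + 2` variables — rung R7 (`exists_winsIn_relBinom_closed`) at
`E = M = 1`, with the relative binomial `relBinom rfl d 1 1 h` rewritten as `X (Fin.last (m+1)) ^ d + rename Fin.castSucc h` (`relBinom_one_one`).  So the class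
of finitely winnable germs is closed under tame suspension, and ITERATING from the plane theorem `winsIn_plane` gives, with no hypothesis and no named fact:

* `exists_winsIn_doubleSuspension` — `x_3 ^ {d_3} + x_2 ^ {d_2} + c(x_0, x_1)` (`c ≠ 0`, `(d_2 : k), (d_3 : k) ≠ 0`) is won in FOUR variables: a fact-free class
  of `HTOT 3`-type instances in the regime of the residual W4|₄ that is neither Brieskorn–Pham (`…NCToricRungBrieskornPham`: `c` is arbitrary), nor Newton
  non-degenerate in general, nor a product / cylinder, and does not use ⟨F-32bR⟩;
* `exists_winsIn_tripleSuspension` — `x_4 ^ {d_4} + x_3 ^ {d_3} + x_2 ^ {d_2} + c(x_0, x_1)` in FIVE variables, likewise; every further storey is one more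
  application of the step.
* `won_of_dvd_tameSuspension_step_pow`, `won_of_dvd_doubleSuspension_pow` — transport to the weighted game (`NCTransport.won_of_winsIn`, p507842): in
  characteristic `p` not dividing the exponents, every divisor of a power of such a germ lies in `CobordantGame.Won k (m + 2)` / `Won k 4`.
-/

noncomputable section

open Literature.AlgebraicGeometry.Resolution

set_option linter.dupNamespace false -- mandated namespace of this single-conjunct summit

namespace Summit.ResolutionOfSingularities.ResolutionOfSingularities.Theorems

namespace NCTransport

open MvPowerSeries TameFourTupleDrop

variable {k : Type} [Field k]

/-! ## The relative binomial with trivial coefficients is the plain suspension -/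

/-- `relBinom rfl d 1 1 h = x_{m+1} ^ d + h` (right block of size one; `bL rfl = Fin.castSucc`, `bR rfl 0 = Fin.last (m + 1)`). -/
theorem relBinom_one_one {m : ℕ} (d : ℕ) (h : MvPowerSeries (Fin (m + 1)) k) :
    relBinom (m := m) (r := 0) (M := m + 1) rfl d 1 1 h = X (Fin.last (m + 1)) ^ d + rename Fin.castSucc h := by
  unfold relBinom
  simp only [map_one, one_mul]
  rfl

/-- A tame suspension is a non-zero series (`d ≠ 0`: the coefficient of `x_{m+1} ^ d` is `1`). -/
theorem tameSuspension_step_ne_zero {m d : ℕ} (hd0 : d ≠ 0) (h : MvPowerSeries (Fin (m + 1)) k) :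
    (X (Fin.last (m + 1)) ^ d + rename Fin.castSucc h : MvPowerSeries (Fin (m + 1 + 1)) k) ≠ 0 := by
  intro h0
  have h2 := congrArg (coeff (Finsupp.single (Fin.last (m + 1)) d)) h0
  rw [map_add, X_pow_eq, coeff_monomial_same, coeff_rename_eq_zero, add_zero, map_zero] at h2
  · exact one_ne_zero h2
  · rintro ⟨e, he⟩
    have h3 : Finsupp.mapDomain Fin.castSucc e (Fin.last (m + 1)) = Finsupp.single (Fin.last (m + 1)) d (Fin.last (m + 1)) := by
      rw [he]
    rw [Finsupp.mapDomain_notin_range _ _ (by rintro ⟨j, hj⟩; exact absurd hj (Fin.castSucc_lt_last j).ne),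
      Finsupp.single_eq_same] at h3
    exact hd0 h3.symm

/-! ## The step: finitely winnable germs are closed under tame suspension -/

/-- **THE TAME-SUSPENSION STEP** (OURS · L1 W4.3 · rung R7 at `E = M = 1`, EVERY field): if `h ≠ 0` in `k⟦x_0, …, x_m⟧` is won by the mover of the NC
count game within finitely many rounds and `(d : k) ≠ 0`, then `x_{m+1} ^ d + h` is won within finitely many rounds in `m + 2` variables. -/
theorem exists_winsIn_tameSuspension_step {m d : ℕ} (hd : (d : k) ≠ 0) {h : MvPowerSeries (Fin (m + 1)) k} (hh : h ≠ 0)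
    (hwin : ∃ n, WinsIn (m := m) GermIsNC n h) :
    ∃ n, WinsIn (m := m + 1) GermIsNC n (X (Fin.last (m + 1)) ^ d + rename Fin.castSucc h) := by
  rw [← relBinom_one_one]
  refine exists_winsIn_relBinom_closed (m := m) (r := 0) (M := m + 1) rfl hd one_ne_zero one_ne_zero hh ?_
  obtain ⟨n, hn⟩ := hwin
  exact ⟨n, by rwa [one_mul, one_mul]⟩

/-- The step in prime characteristic, tameness spelled `p ∤ d`. -/
theorem exists_winsIn_tameSuspension_step_of_not_dvd (p : ℕ) [CharP k p] {m d : ℕ} (hpd : ¬ p ∣ d)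
    {h : MvPowerSeries (Fin (m + 1)) k} (hh : h ≠ 0) (hwin : ∃ n, WinsIn (m := m) GermIsNC n h) :
    ∃ n, WinsIn (m := m + 1) GermIsNC n (X (Fin.last (m + 1)) ^ d + rename Fin.castSucc h) :=
  exists_winsIn_tameSuspension_step (fun h0 => hpd ((CharP.cast_eq_zero_iff k p d).mp h0)) hh hwin

/-! ## Towers over plane curves, fact-free -/

/-- **DOUBLE SUSPENSIONS OF PLANE CURVES ARE WON IN FOUR VARIABLES, FACT-FREE** (OURS · L1 W4.3, every field): for a non-zero plane germ
`c(x_0, x_1)` and `(d_2 : k), (d_3 : k) ≠ 0`, the germ `x_3 ^ {d_3} + (x_2 ^ {d_2} + c(x_0, x_1))` is won by the mover of the NC count game within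
finitely many rounds — `winsIn_plane`, then the step twice. -/
theorem exists_winsIn_doubleSuspension {d₂ d₃ : ℕ} (hd₂ : (d₂ : k) ≠ 0) (hd₃ : (d₃ : k) ≠ 0) (c : MvPowerSeries (Fin 2) k) (hc : c ≠ 0) :
    ∃ n, WinsIn (m := 3) GermIsNC n
      (X (Fin.last 3) ^ d₃ + rename Fin.castSucc (X (Fin.last 2) ^ d₂ + rename Fin.castSucc c : MvPowerSeries (Fin 3) k)) := by
  have hd₂0 : d₂ ≠ 0 := by rintro rfl; exact hd₂ Nat.cast_zero
  exact exists_winsIn_tameSuspension_step (m := 2) hd₃ (tameSuspension_step_ne_zero (m := 1) hd₂0 c)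
    (exists_winsIn_tameSuspension_step (m := 1) hd₂ hc (winsIn_plane k c hc))

/-- **TRIPLE SUSPENSIONS**, five variables, fact-free: `x_4 ^ {d_4} + (x_3 ^ {d_3} + (x_2 ^ {d_2} + c(x_0, x_1)))`. -/
theorem exists_winsIn_tripleSuspension {d₂ d₃ d₄ : ℕ} (hd₂ : (d₂ : k) ≠ 0) (hd₃ : (d₃ : k) ≠ 0) (hd₄ : (d₄ : k) ≠ 0)
    (c : MvPowerSeries (Fin 2) k) (hc : c ≠ 0) :
    ∃ n, WinsIn (m := 4) GermIsNC n
      (X (Fin.last 4) ^ d₄ + rename Fin.castSucc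
        (X (Fin.last 3) ^ d₃ + rename Fin.castSucc (X (Fin.last 2) ^ d₂ + rename Fin.castSucc c : MvPowerSeries (Fin 3) k) :
          MvPowerSeries (Fin 4) k)) := by
  have hd₃0 : d₃ ≠ 0 := by rintro rfl; exact hd₃ Nat.cast_zero
  exact exists_winsIn_tameSuspension_step (m := 3) hd₄ (tameSuspension_step_ne_zero (m := 2) hd₃0 _)
    (exists_winsIn_doubleSuspension hd₂ hd₃ c hc)

/-! ## Transport to the weighted game -/

/-- In characteristic `p` with `p ∤ d`: every divisor of a power of the tame suspension `x_{m+1} ^ d + h` of a finitely winnable `h ≠ 0` lies in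
`CobordantGame.Won k (m + 2)` (`NCTransport.won_of_winsIn`, p507842). [OURS · L1 W4.3] -/
theorem won_of_dvd_tameSuspension_step_pow (p : ℕ) (hp : p.Prime) [CharP k p] {m d : ℕ} (hpd : ¬ p ∣ d)
    {h : MvPowerSeries (Fin (m + 1)) k} (hh : h ≠ 0) (hwin : ∃ n, WinsIn (m := m) GermIsNC n h)
    (N : ℕ) (f : MvPowerSeries (Fin (m + 1 + 1)) k) (hf : f ∣ (X (Fin.last (m + 1)) ^ d + rename Fin.castSucc h) ^ (N + 1)) :
    CobordantGame.Won k (m + 1 + 1) f := by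
  obtain ⟨n, hn⟩ := exists_winsIn_tameSuspension_step_of_not_dvd p hpd hh hwin
  have hd0 : d ≠ 0 := fun h0 => hpd (h0 ▸ dvd_zero p)
  exact won_of_winsIn p hp n _ (tameSuspension_step_ne_zero hd0 h) hn N f hf

/-- **FACT-FREE FOUR-VARIABLE WINS**: in characteristic `p ∤ d_2 d_3`, every divisor of a power of a double suspension
`x_3 ^ {d_3} + x_2 ^ {d_2} + c(x_0, x_1)` (`c ≠ 0`) lies in `CobordantGame.Won k 4`. [OURS · L1 W4.3] -/
theorem won_of_dvd_doubleSuspension_pow (p : ℕ) (hp : p.Prime) [CharP k p] {d₂ d₃ : ℕ} (hpd₂ : ¬ p ∣ d₂) (hpd₃ : ¬ p ∣ d₃)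
    (c : MvPowerSeries (Fin 2) k) (hc : c ≠ 0) (N : ℕ) (f : MvPowerSeries (Fin 4) k)
    (hf : f ∣ (X (Fin.last 3) ^ d₃ + rename Fin.castSucc (X (Fin.last 2) ^ d₂ + rename Fin.castSucc c : MvPowerSeries (Fin 3) k)) ^ (N + 1)) :
    CobordantGame.Won k 4 f := by
  have hd₂ : (d₂ : k) ≠ 0 := fun h0 => hpd₂ ((CharP.cast_eq_zero_iff k p d₂).mp h0)
  have hd₂0 : d₂ ≠ 0 := fun h0 => hpd₂ (h0 ▸ dvd_zero p)
  exact won_of_dvd_tameSuspension_step_pow p hp (m := 2) hpd₃ (tameSuspension_step_ne_zero (m := 1) hd₂0 c)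
    (exists_winsIn_tameSuspension_step (m := 1) hd₂ hc (winsIn_plane k c hc)) N f hf

end NCTransport

end Summit.ResolutionOfSingularities.ResolutionOfSingularities.Theorems
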